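/-
Origin: expansion seat `prover-pub-hodgecm-mc-binder-2-g20-0`, handover #105 2026-08-21T04:20Z md5 bdb637e2f623 (NEW; 368 l.; SLOTS 0 AND 1 over binder-1 #R129's common + slot-k variable blocks VERBATIM (V c S hGR hGR₀ hGR₁ hGR₂ hGR₃ χ₀ χ₁ χ₂ χ₃ hι h₁W hV hemb; per slot hP : (S.P k).ω = lineRepOf … k, hχc, eR eS hχ a hω hdefI) + a recipe μ : GramClass L → InfinitePlace L → ℤ: per slot k ∈ {0,1}: abbrev a{Zero,One}J := ⟨dW c.D k, dW_real c.D k, dW_ne c.D k⟩ (= ⟨c.D.a k,…⟩ by rfl); splitLine{Zero,One}TwistedG_eq_ofCMOf_twistBy (sinst-1's χ_k-twisted record IS #102 ofCMOf at a_k twisted by bigChar_k — delta+rfl), splitLine{Zero,One}TwistedG_scalar (= c.D.a k); **hJ_slot_{zero,one}_of_lineRepOf**: for a side family Sf with Sf V c = S, hGfin ∕ hLF, hη₁V ∕ hη₁W ∕ hc₁ of χ_k, hμ (μ ⟦a_k⟧ = charArchType (centerCharInf (adelicChar_k χ_k)) _ + centralTypeOf V a_k hGR_k, theta-3 #S19's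 split form) and hw ((Hw_k′): (S.P k).w t · adelicChar_k χ_k (CMCenter u_t) = torusScalar_kG … χ_k u_t) ⊢ ∃ T : Finset (LiuIndex.I V (repAt a_k) μ), (∀ j ∈ T, ∃ z ≠ 0, (LiuIndex.line … j).scalar = z z̄ (c.D.a k)) ∧ ∀ Γ (hΓ : BelowConjThree), ∀ ω ∈ thetaOf _ (thetaClassInputOf _ (thetaSpaceInputOf hHD hI h₁ h₃ Sf)) V c k Γ, ∃ cf : towerLevel Γ hΓ, TowerLevel.res cf = ω ∧ (ofLevel Γ hΓ cf : (liuDictionaryPin … V (LiuIndex.I V (repAt a_k) μ) (LiuIndex.line …)).H) ∈ ⨆ j ∈ T, block j — «ATqI»'s hJ V c … at i = k, T := {j_k}; proof = #S19 index ▸ #103 isometry ▸ per ω: sinst-1 #1238 lift ▸ binder-1 #R130 clsU_mem_iSup_block_of_mem_adelicThetaSpanSat_pin_kG (BY NAME) ▸ hol germs (mem_holSatU_iff∕mem_holSat_iff) ▸ tower (#1242∕#1243) ▸ #104 over sinst-1 dictEquiv_kCanonicalG + isAutChar_char_kDictG_of_weight. CERT lane farm lean-direct over the RUN-70 PKG oleans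 of record + the staged RUN-71 bytes of the imports at their TABLE FROZEN₇₁ md5s (binder-1 #R128 775b8d358a35 ∕ #R129 22d85f0f7b2c ∕ #R130 954731491fe8, sinst-1 #1262(PKG) ∕ #1264 31149cea968f ∕ #1265 cc2a0f912f67 ∕ #1266 4db509f76d72 ∕ #1267 cd3287f891c6, theta-3 #S15r2∕#S16r2∕#S18 (PKG) ∕ #S19 r1 482d8c3545ea (r2 fcd01948ca1c is the tabled one — RE-CERT over the installed #S19 after LANDED₇₁), binder-2 #103 (PKG) ∕ #104 7105a451c190): rc 0 ∕ 41 s ∕ 0 warn ∕ 0 proof holes; #print axioms 8 ∕ 8 (both files) ⊆ {propext, Classical.choice, Quot.sound} (g20/farm/logs/ax_jliuslots.log 2d593f699efc); FQN: new names, 0 hits in PKG ∕ the RUN-71 table. NAME LIST (theorems): HodgeCM.Model.ThetaAdelicSide.hJ_slot_zero_of_lineRepOf · HodgeCM.Model.ThetaAdelicSide.hJ_slot_one_of_lineRepOf · HodgeCM.Model.ThetaAdelicSide.splitLineOneTwistedG_scalar. (`HOME/mc/pub-hodgecm-mc-binder-2/g20/stage72/HodgeCM/Model/Binders/JLiuSlots01.lean`,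 md5 bdb637e2f623, 367 lines);
landed by the second packager p2 gen 18 (p2-g18) in gate run 72 as `HodgeCM/Model/Binders/JLiuSlots01.lean` (verbatim).
-/
/-
Origin: BINDER seat `prover-pub-hodgecm-mc-binder-2-g20-0` (unit pub-hodgecm-mc-binder-2-g20, gen 20 of mc-binder-2), 2026-08-21.
Target in PKG: `HodgeCM/Model/Binders/JLiuSlots01.lean` (NEW additive KERNEL leaf beside E; imports binder-2 #104 `Model/Binders/JLiuBlockFamily`,
binder-1 #R130 `Model/AdelicThetaDistributionMultSpanG` (→ #R129 ∕ #R128), sinst-1 #1267 ∕ #1265 `Model/AdelicThetaSlot{Zero,One}AutG`,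
theta-3 #S19 `Model/LiuIndexTwistTypeOfV` — all RUN-71 rows; nothing imports it; outside E's ∕ «AR»'s import closure; MODEL-N ±0).
KERNEL ONLY: theorems + four reducible `abbrev`s (the slot scalars as `RealScalar`s); 0 records, nothing cited, 0 `def … : Prop`.
Nothing here is a claim of the manuscripts under adjudication.
-/
import Summits.HodgeConjecture.HodgeCM.Model.Binders.JLiuBlockFamily
import Summits.HodgeConjecture.HodgeCM.Model.AdelicThetaDistributionMultSpanG_2
import Summits.HodgeConjecture.HodgeCM.Model.AdelicThetaSlotZeroAutG
import Summits.HodgeConjecture.HodgeCM.Model.AdelicThetaSlotOneAutG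
import Summits.HodgeConjecture.HodgeCM.Model.LiuIndexTwistTypeOfV

set_option autoImplicit false

/-!
# (J3) THE JUNCTION BINDER `hJ`, SLOTS 0 AND 1, PIN-GENERICALLY (companion file: the other two slots) — the five lanes' pieces composed

For ANY adelic side `S : ThetaAdelicSide V c` whose slot-`k` line representation reads back to `lineRepOf … χ₀ χ₁ χ₂ χ₃ k` (binder-1 #R128 ∕
#R129's currency; at the R2 pin of record `χ_k := etaT_k η ν(′)`, sinst-1 #1263 ∕ binder-1 #R131) and any side FAMILY `Sf` with `Sf V c = S`
(E quantifies a family), `hJ_slot_{zero,one,two,three}_of_lineRepOf` proves the slot-`k` conjunct of the junction binder `hJ` of the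
junction-form E child («ATqI», binder-2-g20 draft): ONE index `j_k` of theta-3's enumeration `LiuIndex.I V (LiuIndex.repAt a_k) μ` (#S15 r2 ∕
#S16 r2 ∕ #S18 ∕ #S19, pointed by binder-2 #103 at the slot scalar `a_k`) — the index of the χ_k-TWISTED slot record `splitLine_kTwistedG … χ_k`
(sinst-1 #1264 ∕ #1266 ∕ #1268 ∕ #1270) — isometric to `a_k = c.D.a k`, such that EVERY theta class
`ω ∈ thetaOf _ (thetaClassInputOf _ (thetaSpaceInputOf … Sf)) V c k Γ` (E's theta model, `Γ` below conj-three) is `res cf` of a tower vector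
`cf` of level `Γ` with `ofLevel cf ∈ block j_k` of the pinned dictionary (#102 `liuDictionaryPin`).  The slot scalars `⟨dW c.D k, …⟩` ∕
`⟨dW' c.D k, …⟩` (k = 0,1) ARE «ATqI»'s `⟨c.D.a i, c.D.a_real i, c.D.a_ne i⟩` (i = k ∕ k+2) definitionally.

HYPOTHESES per slot (all named; none archimedean-analytic beyond the pin's own identities): binder-1 #R129's pin block `hemb eR eS hχ a hω
hdefI` at `χ_k`; the side facts `hGfin` ∕ `hLF`; `hη₁V` ∕ `hη₁W` (rational triviality of `χ_k`), `hc₁` (continuity of `adelicChar_k χ_k`);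
and the slot's ONE archimedean identity in its two currencies — `hμ` (the recipe value `μ ⟦a_k⟧`, theta-3 #S19's split form) and `hw`
((Hw_k′), sinst-1 ∕ carch #CA70 (CC_k)).  At the R2 pin all of these but `hμ` are discharged by PKG names (binder-1 #R131, sinst-1 #1272 ∕
#1273, carch #CA72 ∕ #CA73; binder-2 probe `SlotOneR2`).

PIECES, by name: sinst-1 #1238 `exists_fixed_adelic_lift_of_mem_thetaOf`; binder-1 #R130 `clsU_mem_iSup_block_of_mem_adelicThetaSpanSat_pin_kG`
(over #R128 §1 ∕ #R129 `pinDatum_kG`), #1242 ∕ #1243 tower (`towerFamily_mem`, `res_towerFamily`, `clsU_eq_clsAt`, `clsAt_apply`,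
`mem_holSatU_iff`, `mem_holSat_iff`); theta-3 #S19 `LiuIndex.I.exists_line_eq_twistBy_bigCharOfV_of_eq`; sinst-1 `dictEquiv_kCanonicalG`,
`isAutChar_char_kDictG_of_weight`; binder-2 #103 `exists_isometric_of_line_eq`, #104 `mem_biSup_block_pin_of_line_eq_of_mem_biSup`.
`#print axioms` ⊆ {propext, Classical.choice, Quot.sound}.
-/

noncomputable section

open NumberField hiding relNormOneIdeles relNormOneRat probHaarRelNormOneQuot
open _root_.NumberField.InfinitePlace _root_.NumberField.mixedEmbedding MeasureTheory MulAction IsDedekindDomain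
open scoped Matrix TensorProduct Classical SchwartzMap
open Literature.Geometry.ComplexHyperbolic.BallModel (U21 x₀ stabilizerEquivK21)
open Literature.NumberTheory.Automorphic.U21 (K21 matA sclD)
open Literature.NumberTheory.Automorphic Literature.NumberTheory.Automorphic.UnitaryGroup Literature.NumberTheory.Weil1964
open Literature.NumberTheory.GelbartRogawski1991 Literature.NumberTheory.GelbartRogawski1991.UnitaryDualPair
open Literature.AlgebraicGeometry.HodgeTheory Literature.AlgebraicGeometry.ShimuraVarieties Literature.AlgebraicGeometry.ShimuraVarieties.BallForms
open Literature.NumberTheory.Automorphic.PicardCM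
open Literature.NumberTheory.Transcendental (Arapura2012_Cor_15_4_6)
open Literature.Analysis.SegalBargmann
open HodgeCM.Adelic HodgeCM.PerL34 HodgeCM.Model.HypCensus HodgeCM.Model.ArchSideTerm HodgeCM.Model.ThetaDistFin HodgeCM.Model.TowerCarrier
open HodgeCM.Model.SupplyInstance HodgeCM.Model.SupplyResidual HodgeCM.Model.ThetaSpace
open HodgeCM.Model.SupplyResidual.WeilPairData (charInv)

open HodgeCM.Model.TowerLevel HodgeCM.Model.TowerCarrier

namespace HodgeCM.Model
namespace ThetaAdelicSide

variable (hHD : exists_isReal_hodgeModel) (hI : hodgePQ_independent_of_hodgeModel)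
  (h₁ : BallQuotientUniformised) (h₃ : CMAbelianVarietyRealised) (hA : Arapura2012_Cor_15_4_6)
variable {L : CMField} {ι₁ : L →+* ℂ} (V : HermSpace3 L ι₁) (c : SeesawCtx L) (S : ThetaAdelicSide V c)
  (hGR : (cmSplittingDatum (L : Type) finProdFinEquiv (frameD V) (frameD_real V) (frameD_ne V) (dW c.D) (dW_real c.D)
    (dW_ne c.D)).CompatibleSplitting)
  (hGR₀ : (cmSplittingDatum (L : Type) (e₁) (frameD V) (frameD_real V) (frameD_ne V) (lineVec (L : Type) (dW c.D 0))
    (fun _ => dW_real c.D 0) (fun _ => dW_ne c.D 0)).CompatibleSplitting)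
  (hGR₁ : (cmSplittingDatum (L : Type) (e₁) (frameD V) (frameD_real V) (frameD_ne V) (lineVec (L : Type) (dW c.D 1))
    (fun _ => dW_real c.D 1) (fun _ => dW_ne c.D 1)).CompatibleSplitting)
  (hGR₂ : (cmSplittingDatum (L : Type) (e₁) (frameD V) (frameD_real V) (frameD_ne V) (lineVec (L : Type) (dW' c.D 0))
    (fun _ => dW'_real c.D 0) (fun _ => dW'_ne c.D 0)).CompatibleSplitting)
  (hGR₃ : (cmSplittingDatum (L : Type) (e₁) (frameD V) (frameD_real V) (frameD_ne V) (lineVec (L : Type) (dW' c.D 1))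
    (fun _ => dW'_real c.D 1) (fun _ => dW'_ne c.D 1)).CompatibleSplitting)
  (χ₀ χ₁ χ₂ χ₃ : CMAdelic (L : Type) (frameD V) × CMAdelicOne (L : Type) →* ℂˣ)
  (hι : S.ιinf = archInfOf V)
  (h₁W : (∀ j, 0 < (ι₁ (dW c.D j)).re) ∨ ∀ j, (ι₁ (dW c.D j)).re < 0)
  (hV : IsAnisotropic L V.Hm)
  (hemb : (InfinitePlace.mk ι₁).embedding = ι₁)

variable (μ : LiuIndex.GramClass L → InfinitePlace (L : Type) → ℤ)

/-! ## Slot 0 -/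

section Zero

variable (hP : (S.P 0).ω = lineRepOf V c.D hGR hGR₀ hGR₁ hGR₂ hGR₃ χ₀ χ₁ χ₂ χ₃ 0)
  (hχc : Continuous fun p => ((χ₀ p : ℂˣ) : ℂ))
  (eR : PosIdx (cmXW (L : Type) (frameD V) (lineVec (L : Type) (dW c.D 0)) (fun _ => dW_real c.D 0) ι₁ (HypCensus.cmPlace (L : Type) ι₁)) ≃ Unit)
  (eS : NegIdx (cmXW (L : Type) (frameD V) (lineVec (L : Type) (dW c.D 0)) (fun _ => dW_real c.D 0) ι₁ (HypCensus.cmPlace (L : Type) ι₁)) ≃ Empty)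
  (hχ : ∀ u : stabilizer U21 x₀,
    ((lineScalar_zero V c.D hGR hGR₀ hGR₁ χ₀ (u : U21) : ℂˣ) : ℂ) *
        ((matA (stabilizerEquivK21.symm u)).det ^ (lineVacExponentsZero V c hGR₀ h₁W eR eS).eP *
          sclD (stabilizerEquivK21.symm u) ^ (lineVacExponentsZero V c hGR₀ h₁W eR eS).eQ) =
      star (sclD (stabilizerEquivK21.symm u)))
  (a : {v : InfinitePlace ↥(maximalRealSubfield L) // v.IsReal} → ℤ)
  (hω : ∀ b : {v : InfinitePlace ↥(maximalRealSubfield L) // v.IsReal}, b ≠ HypCensus.cmPlace (L : Type) ι₁ →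
    ∀ (u : UnitaryGroup.archLocal (L : Type) 3 (Matrix.diagonal (frameD V)) (cmPlaceOver (L : Type) b)) (ℓ : Module.Dual ℂ (Fin 2 → ℂ)),
      cmArchWeilRep (L : Type) e₁ (frameD V) (frameD_real V) (frameD_ne V) (lineVec (L : Type) (dW c.D 0)) (fun _ => dW_real c.D 0)
          (fun _ => dW_ne c.D 0) hGR₀
          (UnitaryGroup.archSingle (↥(maximalRealSubfield L)) L (IsCMField.complexConj L) 3 (Matrix.diagonal (frameD V))
            (IsCMField.complexConj_ne_one L) (NumberField.complexConj_smul_infinitePlace (L : Type)) (cmPlaceOver (L : Type) b) u, 1)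
          (blockFamilyOfAt (L : Type) e₁ (frameD V) (frameD_real V) (frameD_ne V) (lineVec (L : Type) (dW c.D 0)) (fun _ => dW_real c.D 0)
            (fun _ => dW_ne c.D 0) ι₁ (blockPosEquiv V) (blockNegEquiv V) eR eS (degOnePDual Empty) (binvPi 1) ℓ) =
        (((u : UnitaryGroup.archLocal (L : Type) 3 (Matrix.diagonal (frameD V)) (cmPlaceOver (L : Type) b)) : GL (Fin 3) ℂ) :
            Matrix (Fin 3) (Fin 3) ℂ).det ^ a b •
          blockFamilyOfAt (L : Type) e₁ (frameD V) (frameD_real V) (frameD_ne V) (lineVec (L : Type) (dW c.D 0)) (fun _ => dW_real c.D 0)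
            (fun _ => dW_ne c.D 0) ι₁ (blockPosEquiv V) (blockNegEquiv V) eR eS (degOnePDual Empty) (binvPi 1) ℓ)
  (hdefI : ∀ b : {v : InfinitePlace ↥(maximalRealSubfield L) // v.IsReal}, b ≠ HypCensus.cmPlace (L : Type) ι₁ →
    ∀ u : UnitaryGroup.archLocal (L : Type) 3 (Matrix.diagonal (frameD V)) (cmPlaceOver (L : Type) b),
      ((archScalar_zeroG V c.D hGR hGR₀ hGR₁ χ₀
          (UnitaryGroup.archSingle (↥(maximalRealSubfield L)) L (IsCMField.complexConj L) 3 (Matrix.diagonal (frameD V))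
            (IsCMField.complexConj_ne_one L) (NumberField.complexConj_smul_infinitePlace (L : Type)) (cmPlaceOver (L : Type) b) u) : ℂˣ) : ℂ) *
        (((u : UnitaryGroup.archLocal (L : Type) 3 (Matrix.diagonal (frameD V)) (cmPlaceOver (L : Type) b)) : GL (Fin 3) ℂ) :
            Matrix (Fin 3) (Fin 3) ℂ).det ^ a b = 1)



/-- the slot-0 scalar as a `RealScalar`. -/
abbrev aZeroJ : LiuIndex.RealScalar L := ⟨dW c.D 0, dW_real c.D 0, dW_ne c.D 0⟩

/-- sinst-1's twisted slot-0 record IS (#102 `ofCMOf` at `a_0`) twisted by its big character — definitional (`delta` + `rfl`). [folklore] -/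
theorem splitLineZeroTwistedG_eq_ofCMOf_twistBy (hη₁V : ∀ v ∈ CMRat (L : Type) (frameD V), χ₀ (v, 1) = 1) :
    splitLineZeroTwistedG V c hGR hGR₀ hGR₁ χ₀ hη₁V =
      (SplitLineE.ofCMOf V e₁ (LiuIndex.RealScalar.vec (aZeroJ c)) (LiuIndex.RealScalar.vec_real (aZeroJ c))
        (LiuIndex.RealScalar.vec_ne (aZeroJ c)) hGR₀).twistBy (bigCharZeroG V c hGR hGR₀ hGR₁ χ₀)
        (bigCharZeroG_isRatTrivial V c hGR hGR₀ hGR₁ χ₀ hη₁V) := by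
  delta ThetaAdelicSide.splitLineZeroTwistedG ThetaAdelicSide.splitLineZero
  rfl

/-- the twisted slot-0 record's Gram scalar is `c.D.a 0`. [folklore] -/
theorem splitLineZeroTwistedG_scalar (hη₁V : ∀ v ∈ CMRat (L : Type) (frameD V), χ₀ (v, 1) = 1) :
    (splitLineZeroTwistedG V c hGR hGR₀ hGR₁ χ₀ hη₁V).scalar = c.D.a 0 := by
  rw [splitLineZeroTwistedG_eq_ofCMOf_twistBy]
  show (SplitLineE.ofCMOf V e₁ (LiuIndex.RealScalar.vec (aZeroJ c)) (LiuIndex.RealScalar.vec_real (aZeroJ c))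
        (LiuIndex.RealScalar.vec_ne (aZeroJ c)) hGR₀).scalar = c.D.a 0
  rw [SplitLineE.ofCMOf_scalar]
  rfl

include hGR₂ hGR₃ χ₀ χ₂ χ₃ hι hP hχc hemb eR eS hχ a hω hdefI in
/-- **SLOT 0 OF THE JUNCTION BINDER `hJ`, PIN-GENERICALLY, FOR E's THETA MODEL** over any side family `Sf` with `Sf V c = S`, `S` reading
`lineRepOf … χ₀ χ₁ χ₂ χ₃` at slot 0 (R2 pin: `χ₁ := etaT₁ η ν`): the slot-0 conjunct through the χ₁-TWISTED record, `T := {j₁}`,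
modulo the ONE archimedean identity (`hμ` index side in #S19's split currency ∕ `hw` automorphy side, (Hw₁′)), the pin identities, and the
side facts `hGfin` ∕ `hLF` ∕ `hη₁V` ∕ `hη₁W`. -/
theorem hJ_slot_zero_of_lineRepOf
    (Sf : ∀ {L : CMField} {ι₁ : L →+* ℂ} (V : HermSpace3 L ι₁) (c : SeesawCtx L), ThetaAdelicSide V c)
    (hS : Sf V c = S)
    (hGfin : ∀ K : Subgroup ↥V.adelicFin, ThetaDistDatum.satG hV K ≤ S.Gfin) (hLF : (S.P 0).IsLFAction)
    (hη₁V : ∀ v ∈ CMRat (L : Type) (frameD V), χ₀ (v, 1) = 1)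
    (hη₁W : ∀ t₀ ∈ relNormOneRat (↥(maximalRealSubfield L)) L, χ₀ (1, (cmAdelicOneEquivRelNormOne (L : Type)).symm t₀) = 1)
    (hc₁ : Continuous fun v => ((adelicCharZeroG V c hGR hGR₀ hGR₁ χ₀ v : ℂˣ) : ℂ))
    (hμ : μ (LiuIndex.GramClass.mk (aZeroJ c)) =
      Literature.NumberTheory.Automorphic.charArchType (L : Type) (LiuIndex.centerCharInf V (adelicCharZeroG V c hGR hGR₀ hGR₁ χ₀))
          (LiuIndex.continuous_centerCharInf V _ hc₁) +
        LiuIndex.centralTypeOf V (aZeroJ c) hGR₀)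
    (hw : ∀ t : ↥(Literature.NumberTheory.Automorphic.relNormOneInfUnits (↥(maximalRealSubfield L)) L),
      (S.P 0).w t *
          ((adelicCharZeroG V c hGR hGR₀ hGR₁ χ₀ (CMCenter (L : Type) (frameD V)
            ((cmAdelicOneEquivRelNormOne (L : Type)).symm (Literature.NumberTheory.Automorphic.relNormOneInfToIdeles (↥(maximalRealSubfield L)) L t))) : ℂˣ) : ℂ) =
        ((torusScalar_zeroG V c.D hGR hGR₀ hGR₁ χ₀
            ((cmAdelicOneEquivRelNormOne (L : Type)).symm (Literature.NumberTheory.Automorphic.relNormOneInfToIdeles (↥(maximalRealSubfield L)) L t)) : ℂˣ) : ℂ)) :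
    ∃ T : Finset (LiuIndex.I V (LiuIndex.repAt (aZeroJ c)) μ),
      (∀ j ∈ T, ∃ z : (L : Type), z ≠ 0 ∧
        (LiuIndex.line V (LiuIndex.repAt (aZeroJ c)) μ j).scalar = z * conjRingHomK L z * c.D.a 0) ∧
      ∀ (Γ : Level V) (hΓ : Γ.BelowConjThree),
        ∀ ω ∈ thetaOf _ (thetaClassInputOf _ (fun V c => thetaSpaceInputOf hHD hI h₁ h₃ Sf V c)) V c 0 Γ,
          ∃ cf : towerLevel hHD hI (ballQuotientUniformisedDatum_of h₁) h₃ hA Γ hΓ,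
            TowerLevel.res hHD hI (ballQuotientUniformisedDatum_of h₁) h₃ hA cf = ω ∧
              (ofLevel hHD hI (ballQuotientUniformisedDatum_of h₁) h₃ hA Γ hΓ cf :
                  (liuDictionaryPin hHD hI h₁ h₃ hA V (LiuIndex.I V (LiuIndex.repAt (aZeroJ c)) μ)
                    (LiuIndex.line V (LiuIndex.repAt (aZeroJ c)) μ)).H) ∈
                ⨆ j' ∈ T, (liuDictionaryPin hHD hI h₁ h₃ hA V (LiuIndex.I V (LiuIndex.repAt (aZeroJ c)) μ)
                  (LiuIndex.line V (LiuIndex.repAt (aZeroJ c)) μ)).block j' := by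
  -- theta-3 #S19: THE index of the twisted slot record, ONCE
  obtain ⟨j, hj1, hline⟩ : ∃ j : LiuIndex.I V (LiuIndex.repAt (aZeroJ c)) μ, j.1 = LiuIndex.GramClass.mk (aZeroJ c) ∧
      LiuIndex.line V (LiuIndex.repAt (aZeroJ c)) μ j = splitLineZeroTwistedG V c hGR hGR₀ hGR₁ χ₀ hη₁V := by
    rw [splitLineZeroTwistedG_eq_ofCMOf_twistBy]
    exact LiuIndex.I.exists_line_eq_twistBy_bigCharOfV_of_eq V μ (LiuIndex.repAt_mk_self (aZeroJ c)) hGR₀ _ _ hc₁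
      (bigCharZeroG_isRatTrivial V c hGR hGR₀ hGR₁ χ₀ hη₁V) hμ
  refine ⟨{j}, fun j' hj' => ?_, fun Γ hΓ θ hθ => ?_⟩
  · rw [Finset.mem_singleton] at hj'
    subst hj'
    exact exists_isometric_of_line_eq V _ _ hline (splitLineZeroTwistedG_scalar V c hGR hGR₀ hGR₁ χ₀ hη₁V)
  -- sinst-1 #1238: the (J4) lift of the theta class (over the family `Sf`), moved to `S`
  obtain ⟨cl, hclω, -, F, hFsat₀, hpull₀, -⟩ := exists_fixed_adelic_lift_of_mem_thetaOf hHD hI h₁ h₃ Sf V c 0 Γ hV hθ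
  have hFsat : (F : (V.latticeModel printFact_unitaryCompact_holds).G → (Fin 2 → ℂ)) ∈
      adelicThetaSpanSat (S.P 0) S.ιinf (stabilizer U21 x₀).subtype
        (BallForms.isPullbackCocycle_cotangentCocycle.weightOf x₀) (ThetaDistDatum.satG hV Γ.K) (S.P 0).weightFunctions := by
    rw [← hS]; exact hFsat₀
  have hpull : (((pinD hHD hI h₁ h₃ Γ hV).pull cl : weightForms _ _ _) : U21 → Fin 2 → ℂ) =
      (F : (V.latticeModel printFact_unitaryCompact_holds).G → (Fin 2 → ℂ)) ∘ ⇑S.ιinf := by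
    rw [← hS]; exact hpull₀
  have h𝓕 : ∀ f ∈ (S.P 0).weightFunctions,
      ∃ χ : PontryaginDual (↥(relNormOneIdeles (↥(maximalRealSubfield L)) L) ⧸ relNormOneRat (↥(maximalRealSubfield L)) L),
        f = charInv χ := fun f ⟨χ, _, hf⟩ => ⟨χ, hf⟩
  -- binder-1 #R130 at #R129's pin-generic datum
  obtain ⟨hF', hx⟩ := clsU_mem_iSup_block_of_mem_adelicThetaSpanSat_pinZeroG hHD hI h₁ h₃ hA V c S hGR hGR₀ hGR₁ hGR₂ hGR₃
    χ₀ χ₁ χ₂ χ₃ hι h₁W hV hemb hP hχc eR eS hχ a hω hdefI h𝓕 hGfin hLF Γ.K hFsat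
  have hhol : IsHolGerm S.ιinf (F : (V.latticeModel printFact_unitaryCompact_holds).G → (Fin 2 → ℂ)) := by
    obtain ⟨i, hi⟩ := (S.mem_holSatU_iff hV 0).1 hF'
    exact ((S.mem_holSat_iff hV 0 i.1).1 hi).2
  -- binder-1 #1242∕#1243: tower vector and restriction
  refine ⟨⟨_, S.towerFamily_mem hHD hI h₁ h₃ hA hι hV hΓ hFsat hhol⟩, ?_, ?_⟩
  · rw [← hclω]
    exact S.res_towerFamily hHD hI h₁ h₃ hA hV hΓ hFsat hhol _ cl hpull
  have hFΓ : (F : (V.latticeModel printFact_unitaryCompact_holds).G → (Fin 2 → ℂ)) ∈ S.holSat hV 0 Γ (S.P 0).weightFunctions :=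
    (S.mem_holSat_iff hV 0 Γ).2 ⟨hFsat, hhol⟩
  have hU := S.clsU_eq_clsAt hHD hI h₁ h₃ hA hι hV 0 ⟨(F : _ → _), hF'⟩ ⟨Γ, hΓ⟩ hFΓ
  rw [clsAt_apply] at hU
  rw [← hU]
  -- binder-2 #104 over sinst-1 #1266∕#1267 and the (Hw₁′) identity
  exact mem_biSup_block_pin_of_line_eq_of_mem_biSup hHD hI h₁ h₃ hA V _ _
    (fun χ => ((pinDatumZeroG V c S hGR hGR₀ hGR₁ hGR₂ hGR₃ χ₀ χ₁ χ₂ χ₃ hι h₁W hV hemb hP hχc eR eS hχ a hω hdefI).coinvRep χ).asModule)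
    (Finset.mem_singleton_self j) hline (fun χ => charZeroDictG V c hGR hGR₀ hGR₁ χ₀ χ)
    (fun χ hχ𝓕 => isAutChar_charZeroDictG_of_weight V c hGR hGR₀ hGR₁ χ₀ hχc hη₁V hη₁W h₁W χ _
      (WeilPairData.forall_weight_of_charInv_mem_weightFunctions _ hχ𝓕) hw)
    (fun χ _ => (dictEquivZeroCanonicalG V c S hGR hGR₀ hGR₁ hGR₂ hGR₃ χ₀ χ₁ χ₂ χ₃ hι h₁W hV hP hχc hη₁V _ _ _ χ).toLinearMap)
    (fun χ _ => LinearEquiv.surjective _) hx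

end Zero

/-! ## Slot 1 -/

section One

variable (hP : (S.P 1).ω = lineRepOf V c.D hGR hGR₀ hGR₁ hGR₂ hGR₃ χ₀ χ₁ χ₂ χ₃ 1)
  (hχc : Continuous fun p => ((χ₁ p : ℂˣ) : ℂ))
  (eR : PosIdx (cmXW (L : Type) (frameD V) (lineVec (L : Type) (dW c.D 1)) (fun _ => dW_real c.D 1) ι₁ (HypCensus.cmPlace (L : Type) ι₁)) ≃ Unit)
  (eS : NegIdx (cmXW (L : Type) (frameD V) (lineVec (L : Type) (dW c.D 1)) (fun _ => dW_real c.D 1) ι₁ (HypCensus.cmPlace (L : Type) ι₁)) ≃ Empty)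
  (hχ : ∀ u : stabilizer U21 x₀,
    ((lineScalar_one V c.D hGR hGR₀ hGR₁ χ₁ (u : U21) : ℂˣ) : ℂ) *
        ((matA (stabilizerEquivK21.symm u)).det ^ (lineVacExponentsOne V c hGR₁ h₁W eR eS).eP *
          sclD (stabilizerEquivK21.symm u) ^ (lineVacExponentsOne V c hGR₁ h₁W eR eS).eQ) =
      star (sclD (stabilizerEquivK21.symm u)))
  (a : {v : InfinitePlace ↥(maximalRealSubfield L) // v.IsReal} → ℤ)
  (hω : ∀ b : {v : InfinitePlace ↥(maximalRealSubfield L) // v.IsReal}, b ≠ HypCensus.cmPlace (L : Type) ι₁ →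
    ∀ (u : UnitaryGroup.archLocal (L : Type) 3 (Matrix.diagonal (frameD V)) (cmPlaceOver (L : Type) b)) (ℓ : Module.Dual ℂ (Fin 2 → ℂ)),
      cmArchWeilRep (L : Type) e₁ (frameD V) (frameD_real V) (frameD_ne V) (lineVec (L : Type) (dW c.D 1)) (fun _ => dW_real c.D 1)
          (fun _ => dW_ne c.D 1) hGR₁
          (UnitaryGroup.archSingle (↥(maximalRealSubfield L)) L (IsCMField.complexConj L) 3 (Matrix.diagonal (frameD V))
            (IsCMField.complexConj_ne_one L) (NumberField.complexConj_smul_infinitePlace (L : Type)) (cmPlaceOver (L : Type) b) u, 1)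
          (blockFamilyOfAt (L : Type) e₁ (frameD V) (frameD_real V) (frameD_ne V) (lineVec (L : Type) (dW c.D 1)) (fun _ => dW_real c.D 1)
            (fun _ => dW_ne c.D 1) ι₁ (blockPosEquiv V) (blockNegEquiv V) eR eS (degOnePDual Empty) (binvPi 1) ℓ) =
        (((u : UnitaryGroup.archLocal (L : Type) 3 (Matrix.diagonal (frameD V)) (cmPlaceOver (L : Type) b)) : GL (Fin 3) ℂ) :
            Matrix (Fin 3) (Fin 3) ℂ).det ^ a b •
          blockFamilyOfAt (L : Type) e₁ (frameD V) (frameD_real V) (frameD_ne V) (lineVec (L : Type) (dW c.D 1)) (fun _ => dW_real c.D 1)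
            (fun _ => dW_ne c.D 1) ι₁ (blockPosEquiv V) (blockNegEquiv V) eR eS (degOnePDual Empty) (binvPi 1) ℓ)
  (hdefI : ∀ b : {v : InfinitePlace ↥(maximalRealSubfield L) // v.IsReal}, b ≠ HypCensus.cmPlace (L : Type) ι₁ →
    ∀ u : UnitaryGroup.archLocal (L : Type) 3 (Matrix.diagonal (frameD V)) (cmPlaceOver (L : Type) b),
      ((archScalar_oneG V c.D hGR hGR₀ hGR₁ χ₁
          (UnitaryGroup.archSingle (↥(maximalRealSubfield L)) L (IsCMField.complexConj L) 3 (Matrix.diagonal (frameD V))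
            (IsCMField.complexConj_ne_one L) (NumberField.complexConj_smul_infinitePlace (L : Type)) (cmPlaceOver (L : Type) b) u) : ℂˣ) : ℂ) *
        (((u : UnitaryGroup.archLocal (L : Type) 3 (Matrix.diagonal (frameD V)) (cmPlaceOver (L : Type) b)) : GL (Fin 3) ℂ) :
            Matrix (Fin 3) (Fin 3) ℂ).det ^ a b = 1)



/-- the slot-1 Gram scalar as a `LiuIndex.RealScalar` (the pointing scalar of #103 `repAt`). [folklore] -/
abbrev aOneJ : LiuIndex.RealScalar L := ⟨dW c.D 1, dW_real c.D 1, dW_ne c.D 1⟩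

/-- sinst-1's twisted slot-1 record IS (#102 `ofCMOf` at `a_1`) twisted by its big character — definitional (`delta` + `rfl`). [folklore] -/
theorem splitLineOneTwistedG_eq_ofCMOf_twistBy (hη₁V : ∀ v ∈ CMRat (L : Type) (frameD V), χ₁ (v, 1) = 1) :
    splitLineOneTwistedG V c hGR hGR₀ hGR₁ χ₁ hη₁V =
      (SplitLineE.ofCMOf V e₁ (LiuIndex.RealScalar.vec (aOneJ c)) (LiuIndex.RealScalar.vec_real (aOneJ c))
        (LiuIndex.RealScalar.vec_ne (aOneJ c)) hGR₁).twistBy (bigCharOne V c hGR hGR₀ hGR₁ χ₁)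
        (bigCharOne_isRatTrivial V c hGR hGR₀ hGR₁ χ₁ hη₁V) := by
  delta ThetaAdelicSide.splitLineOneTwistedG ThetaAdelicSide.splitLineOne
  rfl

/-- the twisted slot-1 record's Gram scalar is `c.D.a 1`. [folklore] -/
theorem splitLineOneTwistedG_scalar (hη₁V : ∀ v ∈ CMRat (L : Type) (frameD V), χ₁ (v, 1) = 1) :
    (splitLineOneTwistedG V c hGR hGR₀ hGR₁ χ₁ hη₁V).scalar = c.D.a 1 := by
  rw [splitLineOneTwistedG_eq_ofCMOf_twistBy]
  show (SplitLineE.ofCMOf V e₁ (LiuIndex.RealScalar.vec (aOneJ c)) (LiuIndex.RealScalar.vec_real (aOneJ c))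
        (LiuIndex.RealScalar.vec_ne (aOneJ c)) hGR₁).scalar = c.D.a 1
  rw [SplitLineE.ofCMOf_scalar]
  rfl

include hGR₂ hGR₃ χ₀ χ₂ χ₃ hι hP hχc hemb eR eS hχ a hω hdefI in
/-- **SLOT 1 OF THE JUNCTION BINDER `hJ`, PIN-GENERICALLY, FOR E's THETA MODEL** over any side family `Sf` with `Sf V c = S`, `S` reading
`lineRepOf … χ₀ χ₁ χ₂ χ₃` at slot 1 (R2 pin: `χ₁ := etaT₁ η ν`): the slot-1 conjunct through the χ₁-TWISTED record, `T := {j₁}`,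
modulo the ONE archimedean identity (`hμ` index side in #S19's split currency ∕ `hw` automorphy side, (Hw₁′)), the pin identities, and the
side facts `hGfin` ∕ `hLF` ∕ `hη₁V` ∕ `hη₁W`. -/
theorem hJ_slot_one_of_lineRepOf
    (Sf : ∀ {L : CMField} {ι₁ : L →+* ℂ} (V : HermSpace3 L ι₁) (c : SeesawCtx L), ThetaAdelicSide V c)
    (hS : Sf V c = S)
    (hGfin : ∀ K : Subgroup ↥V.adelicFin, ThetaDistDatum.satG hV K ≤ S.Gfin) (hLF : (S.P 1).IsLFAction)
    (hη₁V : ∀ v ∈ CMRat (L : Type) (frameD V), χ₁ (v, 1) = 1)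
    (hη₁W : ∀ t₀ ∈ relNormOneRat (↥(maximalRealSubfield L)) L, χ₁ (1, (cmAdelicOneEquivRelNormOne (L : Type)).symm t₀) = 1)
    (hc₁ : Continuous fun v => ((adelicCharOne V c hGR hGR₀ hGR₁ χ₁ v : ℂˣ) : ℂ))
    (hμ : μ (LiuIndex.GramClass.mk (aOneJ c)) =
      Literature.NumberTheory.Automorphic.charArchType (L : Type) (LiuIndex.centerCharInf V (adelicCharOne V c hGR hGR₀ hGR₁ χ₁))
          (LiuIndex.continuous_centerCharInf V _ hc₁) +
        LiuIndex.centralTypeOf V (aOneJ c) hGR₁)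
    (hw : ∀ t : ↥(Literature.NumberTheory.Automorphic.relNormOneInfUnits (↥(maximalRealSubfield L)) L),
      (S.P 1).w t *
          ((adelicCharOne V c hGR hGR₀ hGR₁ χ₁ (CMCenter (L : Type) (frameD V)
            ((cmAdelicOneEquivRelNormOne (L : Type)).symm (Literature.NumberTheory.Automorphic.relNormOneInfToIdeles (↥(maximalRealSubfield L)) L t))) : ℂˣ) : ℂ) =
        ((torusScalar_oneG V c.D hGR hGR₀ hGR₁ χ₁
            ((cmAdelicOneEquivRelNormOne (L : Type)).symm (Literature.NumberTheory.Automorphic.relNormOneInfToIdeles (↥(maximalRealSubfield L)) L t)) : ℂˣ) : ℂ)) :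
    ∃ T : Finset (LiuIndex.I V (LiuIndex.repAt (aOneJ c)) μ),
      (∀ j ∈ T, ∃ z : (L : Type), z ≠ 0 ∧
        (LiuIndex.line V (LiuIndex.repAt (aOneJ c)) μ j).scalar = z * conjRingHomK L z * c.D.a 1) ∧
      ∀ (Γ : Level V) (hΓ : Γ.BelowConjThree),
        ∀ ω ∈ thetaOf _ (thetaClassInputOf _ (fun V c => thetaSpaceInputOf hHD hI h₁ h₃ Sf V c)) V c 1 Γ,
          ∃ cf : towerLevel hHD hI (ballQuotientUniformisedDatum_of h₁) h₃ hA Γ hΓ,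
            TowerLevel.res hHD hI (ballQuotientUniformisedDatum_of h₁) h₃ hA cf = ω ∧
              (ofLevel hHD hI (ballQuotientUniformisedDatum_of h₁) h₃ hA Γ hΓ cf :
                  (liuDictionaryPin hHD hI h₁ h₃ hA V (LiuIndex.I V (LiuIndex.repAt (aOneJ c)) μ)
                    (LiuIndex.line V (LiuIndex.repAt (aOneJ c)) μ)).H) ∈
                ⨆ j' ∈ T, (liuDictionaryPin hHD hI h₁ h₃ hA V (LiuIndex.I V (LiuIndex.repAt (aOneJ c)) μ)
                  (LiuIndex.line V (LiuIndex.repAt (aOneJ c)) μ)).block j' := by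
  -- theta-3 #S19: THE index of the twisted slot record, ONCE
  obtain ⟨j, hj1, hline⟩ : ∃ j : LiuIndex.I V (LiuIndex.repAt (aOneJ c)) μ, j.1 = LiuIndex.GramClass.mk (aOneJ c) ∧
      LiuIndex.line V (LiuIndex.repAt (aOneJ c)) μ j = splitLineOneTwistedG V c hGR hGR₀ hGR₁ χ₁ hη₁V := by
    rw [splitLineOneTwistedG_eq_ofCMOf_twistBy]
    exact LiuIndex.I.exists_line_eq_twistBy_bigCharOfV_of_eq V μ (LiuIndex.repAt_mk_self (aOneJ c)) hGR₁ _ _ hc₁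
      (bigCharOne_isRatTrivial V c hGR hGR₀ hGR₁ χ₁ hη₁V) hμ
  refine ⟨{j}, fun j' hj' => ?_, fun Γ hΓ θ hθ => ?_⟩
  · rw [Finset.mem_singleton] at hj'
    subst hj'
    exact exists_isometric_of_line_eq V _ _ hline (splitLineOneTwistedG_scalar V c hGR hGR₀ hGR₁ χ₁ hη₁V)
  -- sinst-1 #1238: the (J4) lift of the theta class (over the family `Sf`), moved to `S`
  obtain ⟨cl, hclω, -, F, hFsat₀, hpull₀, -⟩ := exists_fixed_adelic_lift_of_mem_thetaOf hHD hI h₁ h₃ Sf V c 1 Γ hV hθ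
  have hFsat : (F : (V.latticeModel printFact_unitaryCompact_holds).G → (Fin 2 → ℂ)) ∈
      adelicThetaSpanSat (S.P 1) S.ιinf (stabilizer U21 x₀).subtype
        (BallForms.isPullbackCocycle_cotangentCocycle.weightOf x₀) (ThetaDistDatum.satG hV Γ.K) (S.P 1).weightFunctions := by
    rw [← hS]; exact hFsat₀
  have hpull : (((pinD hHD hI h₁ h₃ Γ hV).pull cl : weightForms _ _ _) : U21 → Fin 2 → ℂ) =
      (F : (V.latticeModel printFact_unitaryCompact_holds).G → (Fin 2 → ℂ)) ∘ ⇑S.ιinf := by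
    rw [← hS]; exact hpull₀
  have h𝓕 : ∀ f ∈ (S.P 1).weightFunctions,
      ∃ χ : PontryaginDual (↥(relNormOneIdeles (↥(maximalRealSubfield L)) L) ⧸ relNormOneRat (↥(maximalRealSubfield L)) L),
        f = charInv χ := fun f ⟨χ, _, hf⟩ => ⟨χ, hf⟩
  -- binder-1 #R130 at #R129's pin-generic datum
  obtain ⟨hF', hx⟩ := clsU_mem_iSup_block_of_mem_adelicThetaSpanSat_pinOneG hHD hI h₁ h₃ hA V c S hGR hGR₀ hGR₁ hGR₂ hGR₃
    χ₀ χ₁ χ₂ χ₃ hι h₁W hV hemb hP hχc eR eS hχ a hω hdefI h𝓕 hGfin hLF Γ.K hFsat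
  have hhol : IsHolGerm S.ιinf (F : (V.latticeModel printFact_unitaryCompact_holds).G → (Fin 2 → ℂ)) := by
    obtain ⟨i, hi⟩ := (S.mem_holSatU_iff hV 1).1 hF'
    exact ((S.mem_holSat_iff hV 1 i.1).1 hi).2
  -- binder-1 #1242∕#1243: tower vector and restriction
  refine ⟨⟨_, S.towerFamily_mem hHD hI h₁ h₃ hA hι hV hΓ hFsat hhol⟩, ?_, ?_⟩
  · rw [← hclω]
    exact S.res_towerFamily hHD hI h₁ h₃ hA hV hΓ hFsat hhol _ cl hpull
  have hFΓ : (F : (V.latticeModel printFact_unitaryCompact_holds).G → (Fin 2 → ℂ)) ∈ S.holSat hV 1 Γ (S.P 1).weightFunctions :=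
    (S.mem_holSat_iff hV 1 Γ).2 ⟨hFsat, hhol⟩
  have hU := S.clsU_eq_clsAt hHD hI h₁ h₃ hA hι hV 1 ⟨(F : _ → _), hF'⟩ ⟨Γ, hΓ⟩ hFΓ
  rw [clsAt_apply] at hU
  rw [← hU]
  -- binder-2 #104 over sinst-1 #1264∕#1265 and the (Hw₁′) identity
  exact mem_biSup_block_pin_of_line_eq_of_mem_biSup hHD hI h₁ h₃ hA V _ _
    (fun χ => ((pinDatumOneG V c S hGR hGR₀ hGR₁ hGR₂ hGR₃ χ₀ χ₁ χ₂ χ₃ hι h₁W hV hemb hP hχc eR eS hχ a hω hdefI).coinvRep χ).asModule)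
    (Finset.mem_singleton_self j) hline (fun χ => charOneDictG V c hGR hGR₀ hGR₁ χ₁ χ)
    (fun χ hχ𝓕 => isAutChar_charOneDictG_of_weight V c hGR hGR₀ hGR₁ χ₁ hχc hη₁V hη₁W h₁W χ _
      (WeilPairData.forall_weight_of_charInv_mem_weightFunctions _ hχ𝓕) hw)
    (fun χ _ => (dictEquivOneCanonicalG V c S hGR hGR₀ hGR₁ hGR₂ hGR₃ χ₀ χ₁ χ₂ χ₃ hι hV hP hχc hη₁V _ _ _ χ).toLinearMap)
    (fun χ _ => LinearEquiv.surjective _) hx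

end One

end ThetaAdelicSide
end HodgeCM.Model

end
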